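import Summits.Ventures.HodgeRepro2.T5SU11JacobiWeightDeriv
import Summits.Ventures.HodgeRepro2.T5SU11JacobiWeightAsymptotic

/-!
# The mean phase for large weight: `k · ⟨log|a|⟩_{k,λ} → 1` for every `λ`

For `λ = 0` the mean phase is exactly `1/(k − 2)` (`T5SU11JacobiPhaseMoments`). For every `λ` the same
leading behaviour follows from two structural facts alone — `f(k) = log m̂_k(λ)` is CONVEX in the weight
(`T5SU11JacobiWeight`) with `f'(k) = −⟨log|a|⟩_{k,λ}` (`T5SU11JacobiWeightDeriv`), and
`k · m̂_k(λ) → 2π` (`T5SU11JacobiWeightAsymptotic`), i.e. `f(k) = log(2π) − log k + o(1)`: the derivative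
of a convex function is squeezed between its difference quotients,

  `(f(k) − f((1−δ)k))/(δk) ≤ f'(k) ≤ (f((1+δ)k) − f(k))/(δk)`,

and `k` times the two quotients tend to `log(1−δ)/δ ≥ −1/(1−δ)` and `−log(1+δ)/δ ≤ −1/(1+δ)`
(`Real.one_sub_inv_le_log_of_pos`), which pinch `−1` as `δ → 0`. Hence

  **`k · f'(k) → −1`, i.e. `k · ⟨log|a|⟩_{k,λ} → 1`**   (`tendsto_mul_deriv_log_jacobi_weight`, `tendsto_mul_mean_phase`),

the mean phase is `∼ 1/k` uniformly in the parameter (`mean_phase_isEquivalent`). Nothing is claimed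
about (N).

Blind lane: Mathlib + the HodgeRepro2 prefix only; no sorry; axioms ⊆ {propext, Classical.choice,
Quot.sound}.
-/

namespace Summit.Ventures.HodgeRepro2.T5SU11JacobiMeanPhaseAsymptotic

open MeasureTheory MeasureTheory.Measure Metric Set Filter Topology Asymptotics
open T5SU11Unimodular T5SU11Fibration T5SU11Cartan T5HaarCircle T5BergmanCoefficient
  T5SU11FibrationHaar T5SU11SphericalFunction T5SU11SphericalSymmetry T5SU11JacobiIwasawa
  T5SU11JacobiTransform T5SU11KFiniteMajorantPow T5SU11JacobiWeight T5SU11JacobiWeightDeriv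
  T5SU11JacobiWeightAsymptotic
open scoped Real

/-! ### Elementary bounds on the logarithm -/

/-- `−log(1+δ)/δ ≤ −1/(1+δ)` for `δ > 0`. -/
lemma neg_log_div_le {δ : ℝ} (hδ : 0 < δ) : -Real.log (1 + δ) / δ ≤ -1 / (1 + δ) := by
  have h := Real.one_sub_inv_le_log_of_pos (by linarith : (0 : ℝ) < 1 + δ)
  have h1 : 0 < 1 + δ := by linarith
  rw [div_le_div_iff₀ hδ h1]
  have e : (1 : ℝ) - (1 + δ)⁻¹ = δ / (1 + δ) := by
    field_simp
    ring
  rw [e, div_le_iff₀ h1] at h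
  linarith

/-- `log(1−δ)/δ ≥ −1/(1−δ)` for `0 < δ < 1`. -/
lemma log_div_ge {δ : ℝ} (hδ : 0 < δ) (hδ1 : δ < 1) : -1 / (1 - δ) ≤ Real.log (1 - δ) / δ := by
  have h1 : 0 < 1 - δ := by linarith
  have h := Real.one_sub_inv_le_log_of_pos h1
  rw [div_le_div_iff₀ h1 hδ]
  have e : (1 : ℝ) - (1 - δ)⁻¹ = -δ / (1 - δ) := by
    field_simp
    ring
  rw [e, div_le_iff₀ h1] at h
  linarith

section measure

variable [MeasurableSpace Circle] [BorelSpace Circle]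

/-! ### The difference quotients of `log m̂_k(λ)` along `k ↦ (1 ± δ)k` -/

/-- `log(k · m̂_k(λ)) → log(2π)`. -/
lemma tendsto_log_mul_jacobi (lam : ℝ) :
    Tendsto (fun k : ℝ => Real.log (k * ∫ g, (1 - ‖orbit g‖ ^ 2) ^ (k / 2) * sph lam g ∂(nu haarCircle)))
      atTop (𝓝 (Real.log (2 * π))) :=
  (Real.continuousAt_log (by positivity)).tendsto.comp (tendsto_mul_jacobi_weight lam)

/-- `log m̂_k(λ) = log(k m̂_k(λ)) − log k` on the ray. -/
lemma log_jacobi_eq {k lam : ℝ} (hk : 1 < k) (h1 : lam < k) (h2 : 2 < k + lam) :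
    Real.log (∫ g, (1 - ‖orbit g‖ ^ 2) ^ (k / 2) * sph lam g ∂(nu haarCircle))
      = Real.log (k * ∫ g, (1 - ‖orbit g‖ ^ 2) ^ (k / 2) * sph lam g ∂(nu haarCircle)) - Real.log k := by
  rw [Real.log_mul (by linarith) (jacobi_pos hk h1 h2).ne']
  ring

/-- The upper difference quotient: `(f((1+δ)k) − f(k))/δ → −log(1+δ)/δ`. -/
lemma tendsto_quotient_up (lam : ℝ) {δ : ℝ} (hδ : 0 < δ) :
    Tendsto (fun k : ℝ =>
      (Real.log (∫ g, (1 - ‖orbit g‖ ^ 2) ^ ((1 + δ) * k / 2) * sph lam g ∂(nu haarCircle))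
        - Real.log (∫ g, (1 - ‖orbit g‖ ^ 2) ^ (k / 2) * sph lam g ∂(nu haarCircle))) / δ)
      atTop (𝓝 (-Real.log (1 + δ) / δ)) := by
  have hL := tendsto_log_mul_jacobi lam
  have hL' := hL.comp (tendsto_id.const_mul_atTop (by linarith : (0 : ℝ) < 1 + δ))
  have h := ((hL'.sub hL).sub_const (Real.log (1 + δ))).div_const δ
  rw [sub_self, zero_sub] at h
  refine h.congr' ?_
  filter_upwards [eventually_gt_atTop (max 1 (max lam (2 - lam)))] with k hk
  rw [max_lt_iff, max_lt_iff] at hk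
  have hk0 : 0 < k := by linarith
  have hk' : 1 < (1 + δ) * k := by nlinarith
  have h1' : lam < (1 + δ) * k := by nlinarith
  have h2' : 2 < (1 + δ) * k + lam := by nlinarith
  simp only [Function.comp_apply, id]
  rw [log_jacobi_eq hk.1 hk.2.1 (by linarith [hk.2.2]), log_jacobi_eq hk' h1' h2',
    Real.log_mul (by linarith) hk0.ne']
  ring

/-- The lower difference quotient: `(f(k) − f((1−δ)k))/δ → log(1−δ)/δ`. -/
lemma tendsto_quotient_down (lam : ℝ) {δ : ℝ} (hδ : 0 < δ) (hδ1 : δ < 1) :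
    Tendsto (fun k : ℝ =>
      (Real.log (∫ g, (1 - ‖orbit g‖ ^ 2) ^ (k / 2) * sph lam g ∂(nu haarCircle))
        - Real.log (∫ g, (1 - ‖orbit g‖ ^ 2) ^ ((1 - δ) * k / 2) * sph lam g ∂(nu haarCircle))) / δ)
      atTop (𝓝 (Real.log (1 - δ) / δ)) := by
  have hL := tendsto_log_mul_jacobi lam
  have hL' := hL.comp (tendsto_id.const_mul_atTop (by linarith : (0 : ℝ) < 1 - δ))
  have h := ((hL.sub hL').add_const (Real.log (1 - δ))).div_const δ
  rw [sub_self, zero_add] at h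
  refine h.congr' ?_
  filter_upwards [eventually_gt_atTop (max 1 (max lam (2 - lam)) / (1 - δ)),
    eventually_gt_atTop (max 1 (max lam (2 - lam)))] with k hk hk0'
  rw [max_lt_iff, max_lt_iff] at hk0'
  have hk0 : 0 < k := by linarith
  have h1δ : 0 < 1 - δ := by linarith
  have hK : max 1 (max lam (2 - lam)) < (1 - δ) * k := by
    rwa [div_lt_iff₀ h1δ, mul_comm] at hk
  rw [max_lt_iff, max_lt_iff] at hK
  simp only [Function.comp_apply, id]
  rw [log_jacobi_eq hk0'.1 hk0'.2.1 (by linarith [hk0'.2.2]), log_jacobi_eq hK.1 hK.2.1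
    (by linarith [hK.2.2]), Real.log_mul h1δ.ne' hk0.ne']
  ring

/-! ### The squeeze -/

/-- **`k · (d/dk) log m̂_k(λ) → −1`** as `k → ∞`, for every `λ`. -/
theorem tendsto_mul_deriv_log_jacobi_weight (lam : ℝ) :
    Tendsto (fun k : ℝ => k * deriv (fun k => Real.log
      (∫ g, (1 - ‖orbit g‖ ^ 2) ^ (k / 2) * sph lam g ∂(nu haarCircle))) k) atTop (𝓝 (-1)) := by
  set f : ℝ → ℝ := fun k => Real.log (∫ g, (1 - ‖orbit g‖ ^ 2) ^ (k / 2) * sph lam g ∂(nu haarCircle))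
    with hf
  have hconv := convexOn_log_jacobi_weight lam
  set K₀ : ℝ := max 1 (max lam (2 - lam)) with hK₀
  have hder : ∀ k, K₀ < k → HasDerivAt f (deriv f k) k := by
    intro k hk
    rw [hK₀, max_lt_iff, max_lt_iff] at hk
    exact (hasDerivAt_log_jacobi_weight hk.1 hk.2.1 (by linarith [hk.2.2])).differentiableAt.hasDerivAt
  rw [tendsto_order]
  constructor
  · -- lower bound: for `a < −1` pick `δ` with `−1/(1−δ) > a`
    intro a ha
    have h1 : Tendsto (fun δ : ℝ => -1 / (1 - δ)) (𝓝[>] 0) (𝓝 (-1)) := by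
      have hc : ContinuousAt (fun δ : ℝ => -1 / (1 - δ)) 0 :=
        continuousAt_const.div (continuousAt_const.sub continuousAt_id) (by norm_num)
      have h := hc.tendsto
      simp only [sub_zero, div_one] at h
      exact h.mono_left nhdsWithin_le_nhds
    obtain ⟨δ, hδa, hδ0, hδ1⟩ := ((h1.eventually_const_lt ha).and
      (Ioo_mem_nhdsGT (zero_lt_one' ℝ))).exists
    have hq := tendsto_quotient_down lam hδ0 hδ1
    have hlt : a < Real.log (1 - δ) / δ := lt_of_lt_of_le hδa (log_div_ge hδ0 hδ1)
    filter_upwards [hq.eventually_const_lt hlt,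
      eventually_gt_atTop (K₀ / (1 - δ)), eventually_gt_atTop K₀] with k hk hk1 hk2
    have h1δ : 0 < 1 - δ := by linarith
    have hk0 : 0 < k := by
      have : 0 < K₀ := by rw [hK₀]; exact lt_of_lt_of_le one_pos (le_max_left _ _)
      linarith
    have hK : K₀ < (1 - δ) * k := by rwa [div_lt_iff₀ h1δ, mul_comm] at hk1
    have hslope := hconv.slope_le_of_hasDerivAt (mem_Ioi.mpr hK) (mem_Ioi.mpr hk2)
      (by nlinarith) (hder k hk2)
    rw [slope_def_field] at hslope
    -- `(f k − f((1−δ)k))/(δk) ≤ f'(k)`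
    have e : k - (1 - δ) * k = δ * k := by ring
    rw [e, div_le_iff₀ (by positivity)] at hslope
    calc a < (f k - f ((1 - δ) * k)) / δ := hk
      _ ≤ k * deriv f k := by
          rw [div_le_iff₀ hδ0]
          linarith
  · -- upper bound: for `b > −1` pick `δ` with `−1/(1+δ) < b`
    intro b hb
    have h1 : Tendsto (fun δ : ℝ => -1 / (1 + δ)) (𝓝[>] 0) (𝓝 (-1)) := by
      have hc : ContinuousAt (fun δ : ℝ => -1 / (1 + δ)) 0 :=
        continuousAt_const.div (continuousAt_const.add continuousAt_id) (by norm_num)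
      have h := hc.tendsto
      simp only [add_zero, div_one] at h
      exact h.mono_left nhdsWithin_le_nhds
    obtain ⟨δ, hδb, hδ0, _⟩ := ((h1.eventually_lt_const hb).and
      (Ioo_mem_nhdsGT (zero_lt_one' ℝ))).exists
    have hq := tendsto_quotient_up lam hδ0
    have hlt : -Real.log (1 + δ) / δ < b := lt_of_le_of_lt (neg_log_div_le hδ0) hδb
    filter_upwards [hq.eventually_lt_const hlt, eventually_gt_atTop K₀] with k hk hk2
    have hk0 : 0 < k := by
      have : 0 < K₀ := by rw [hK₀]; exact lt_of_lt_of_le one_pos (le_max_left _ _)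
      linarith
    have hK : K₀ < (1 + δ) * k := by nlinarith
    have hslope := hconv.le_slope_of_hasDerivAt (mem_Ioi.mpr hk2) (mem_Ioi.mpr hK)
      (by nlinarith) (hder k hk2)
    rw [slope_def_field] at hslope
    have e : (1 + δ) * k - k = δ * k := by ring
    rw [e, le_div_iff₀ (by positivity)] at hslope
    calc k * deriv f k ≤ (f ((1 + δ) * k) - f k) / δ := by
          rw [le_div_iff₀ hδ0]
          linarith
      _ < b := hk

/-- **`k · ⟨log|a|⟩_{k,λ} → 1`**: the mean phase is `1/k` to leading order, for every `λ`. -/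
theorem tendsto_mul_mean_phase (lam : ℝ) :
    Tendsto (fun k : ℝ => k *
      ((∫ g, Real.log ‖mat g 0 0‖ * ((1 - ‖orbit g‖ ^ 2) ^ (k / 2) * sph lam g) ∂(nu haarCircle))
        / ∫ g, (1 - ‖orbit g‖ ^ 2) ^ (k / 2) * sph lam g ∂(nu haarCircle))) atTop (𝓝 1) := by
  have h := (tendsto_mul_deriv_log_jacobi_weight lam).neg
  rw [neg_neg] at h
  refine h.congr' ?_
  filter_upwards [eventually_gt_atTop (max 1 (max lam (2 - lam)))] with k hk
  rw [max_lt_iff, max_lt_iff] at hk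
  rw [deriv_log_jacobi_weight hk.1 hk.2.1 (by linarith [hk.2.2])]
  ring

/-- `⟨log|a|⟩_{k,λ} ∼ 1/k` as `k → ∞`. -/
theorem mean_phase_isEquivalent (lam : ℝ) :
    (fun k : ℝ =>
      (∫ g, Real.log ‖mat g 0 0‖ * ((1 - ‖orbit g‖ ^ 2) ^ (k / 2) * sph lam g) ∂(nu haarCircle))
        / ∫ g, (1 - ‖orbit g‖ ^ 2) ^ (k / 2) * sph lam g ∂(nu haarCircle)) ~[atTop] fun k => 1 / k := by
  refine isEquivalent_of_tendsto_one ?_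
  refine (tendsto_mul_mean_phase lam).congr' ?_
  filter_upwards [eventually_gt_atTop (0 : ℝ)] with k hk
  simp only [Pi.div_apply]
  field_simp

end measure

end Summit.Ventures.HodgeRepro2.T5SU11JacobiMeanPhaseAsymptotic
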